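import Summits.NavierStokesRegularity.NavierStokesRegularity.Theorems.ScalingDefectPeepholeDoorTubeResidual

/-!
# ScalingDefectPeepholeDoorTubeDefect — door S30 «ScalingDefectPeepholeDoor» v2 (nsreg-p1 g24 ROUND-28 v2 6cf1a9889313ec10),
# plate P2 = K1ω `VortexDefectTubeBound`, part T2b: THE HOLOMORPHIC EXTENSION OF THE VORTICITY DEFECT

The SCV half of K1ω, concluded: if the window field `W` (class `C³` on `B(0, A+1)`) has a bounded holomorphic extension `U` to the
tube `localComplexTube 0 (A+1) δ₀` (‖U‖ ≤ K₀), then the vorticity defect `vortexDefect 1 W = curl (ssResidual 1 W)` (Defs §0) has a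
holomorphic extension `F` to `localComplexTube 0 A δ` bounded by `K`, with `δ = δ(δ₀) > 0` and `K = K(K₀, A, δ₀)` — EXACTLY the
`∃ F, …` block of `VortexDefectTubeBound`.  Proof: part T2a extends the residual (`exists_ssResidual_extension`); one more round of
the `∂ᵥ`-extension lemma (part T1) in the three coordinate directions extends `∂ₖ(ssResidual 1 W)` with Cauchy bounds and real-slice
agreement; the curl is the fixed linear combination of their components.

* `differentiableOn_ssResidual` — `ssResidual 1 W` is differentiable on an open ball where `W ∈ C³`.
* `exists_vortexDefect_extension` — `∀ A δ₀ K₀, ∃ δ K > 0, ∀ U W, (tube extension of W) → ∃ F, (the K1ω block)`.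

What remains for K1ω after this file is the NS half (part T3): producing `U` for the window field of a Pineau–Vicol-class solution at
late times from the tree's BGK sup-bound theorem (`bradshawGrujicKukavica2015_local_analyticity_radius_supBound`).  Door S30 is a
regularity CRITERION inside a HYPOTHETICAL local Type-I blow-up (item 0056 `NoTypeII` stays OPEN); nothing here bears on NS regularity.
-/

noncomputable section

set_option linter.dupNamespace false

namespace Summit.NavierStokesRegularity.NavierStokesRegularity.Theorems.ScalingDefectPeepholeDoor

open Set Function Filter Metric TopologicalSpace Complex InnerProductSpace
open scoped Topology Laplacian ContDiff
open Literature.Analysis Literature.Analysis.FluidPDE Literature.Analysis.Complex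
open Literature.Analysis.FunctionSpaces.EuclideanSpace (complexify norm_complexify complexify_apply)

-- nested operator types
set_option maxSynthPendingDepth 3

/-- **`ssResidual 1 W` is differentiable on an open ball where `W ∈ C³`.** -/
theorem differentiableOn_ssResidual {W : EuclideanSpace ℝ (Fin 3) → EuclideanSpace ℝ (Fin 3)} {R : ℝ}
    (hW : ContDiffOn ℝ 3 W (ball (0 : EuclideanSpace ℝ (Fin 3)) R)) :
    DifferentiableOn ℝ (ssResidual 1 W) (ball (0 : EuclideanSpace ℝ (Fin 3)) R) := by
  have h2 : ContDiffOn ℝ 2 (fun y => fderiv ℝ W y) (ball (0 : EuclideanSpace ℝ (Fin 3)) R) :=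
    hW.fderiv_of_isOpen isOpen_ball (m := 2) (by norm_num)
  have h1 : ContDiffOn ℝ 1 (fun y => fderiv ℝ (fderiv ℝ W) y) (ball (0 : EuclideanSpace ℝ (Fin 3)) R) :=
    h2.fderiv_of_isOpen isOpen_ball (m := 1) (by norm_num)
  have hW1 : ContDiffOn ℝ 1 W (ball (0 : EuclideanSpace ℝ (Fin 3)) R) := hW.of_le (by norm_num)
  have h21 : ContDiffOn ℝ 1 (fun y => fderiv ℝ W y) (ball (0 : EuclideanSpace ℝ (Fin 3)) R) := h2.of_le (by norm_num)
  have hLap : ContDiffOn ℝ 1 (fun y => (Δ W) y) (ball (0 : EuclideanSpace ℝ (Fin 3)) R) := by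
    have e : (fun y => (Δ W) y) = fun y => ∑ i, fderiv ℝ (fderiv ℝ W) y
        (EuclideanSpace.basisFun (Fin 3) ℝ i) (EuclideanSpace.basisFun (Fin 3) ℝ i) :=
      funext fun y => laplacian_apply_eq_sum_fderiv_fderiv_basisFun _ _
    rw [e]
    exact ContDiffOn.sum fun i _ => (h1.clm_apply contDiffOn_const).clm_apply contDiffOn_const
  have e : ssResidual 1 W = fun y => (1 : ℝ) • (Δ W) y - fderiv ℝ W y (W y) - (1 / 2 : ℝ) • W y
      - (1 / 2 : ℝ) • fderiv ℝ W y y := rfl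
  rw [e]
  exact ((((hLap.const_smul (1 : ℝ)).sub (h21.clm_apply hW1)).sub (hW1.const_smul _)).sub
    ((h21.clm_apply contDiffOn_id).const_smul _)).differentiableOn (by norm_num)

/-- the Euclidean norm of a vector of `ℂ³` whose three coordinates are bounded by `c ≥ 0` is at most `2c`. -/
theorem norm_le_two_mul_of_forall_apply_le {w : EuclideanSpace ℂ (Fin 3)} {c : ℝ} (hc : 0 ≤ c) (h : ∀ i, ‖w i‖ ≤ c) :
    ‖w‖ ≤ 2 * c := by
  rw [EuclideanSpace.norm_eq]
  have hs : ∑ i : Fin 3, ‖w i‖ ^ 2 ≤ (2 * c) ^ 2 := by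
    calc ∑ i : Fin 3, ‖w i‖ ^ 2 ≤ ∑ _i : Fin 3, c ^ 2 :=
          Finset.sum_le_sum fun i _ => pow_le_pow_left₀ (norm_nonneg _) (h i) 2
      _ = 3 * c ^ 2 := by simp
      _ ≤ (2 * c) ^ 2 := by nlinarith
  exact (Real.sqrt_le_sqrt hs).trans (le_of_eq (Real.sqrt_sq (by positivity)))

set_option maxHeartbeats 1600000 in
/-- **The vorticity defect of the window field extends holomorphically to a tube with a class bound** (SCV half of K1ω): for
`A ≥ 1`, `δ₀ > 0`, `K₀ ≥ 0` there are `δ > 0` and `K > 0` such that whenever `U` is holomorphic on `localComplexTube 0 (A+1) δ₀` with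
`‖U‖ ≤ K₀` and agrees with `complexify ∘ W` on `B(0, A+1)`, `W ∈ C³(B(0, A+1))`, there is `F` holomorphic on `localComplexTube 0 A δ`,
`‖F‖ ≤ K` there, with `F (complexify y) = complexify (vortexDefect 1 W y)` for `‖y‖ < A`. -/
theorem exists_vortexDefect_extension (A δ₀ K₀ : ℝ) (hA : 1 ≤ A) (hδ₀ : 0 < δ₀) (hK₀ : 0 ≤ K₀) :
    ∃ δ K : ℝ, 0 < δ ∧ 0 < K ∧
    ∀ (U : EuclideanSpace ℂ (Fin 3) → EuclideanSpace ℂ (Fin 3)) (W : EuclideanSpace ℝ (Fin 3) → EuclideanSpace ℝ (Fin 3)),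
      DifferentiableOn ℂ U (localComplexTube 0 (A + 1) δ₀) →
      (∀ z ∈ localComplexTube (0 : EuclideanSpace ℝ (Fin 3)) (A + 1) δ₀, ‖U z‖ ≤ K₀) →
      ContDiffOn ℝ 3 W (ball (0 : EuclideanSpace ℝ (Fin 3)) (A + 1)) →
      (∀ y ∈ ball (0 : EuclideanSpace ℝ (Fin 3)) (A + 1), U (complexify y) = complexify (W y)) →
      ∃ F : EuclideanSpace ℂ (Fin 3) → EuclideanSpace ℂ (Fin 3),
        DifferentiableOn ℂ F (localComplexTube (0 : EuclideanSpace ℝ (Fin 3)) A δ) ∧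
        (∀ z ∈ localComplexTube (0 : EuclideanSpace ℝ (Fin 3)) A δ, ‖F z‖ ≤ K) ∧
        ∀ y : EuclideanSpace ℝ (Fin 3), ‖y‖ < A → F (complexify y) = complexify (vortexDefect 1 W y) := by
  -- shrink the height to `δ₁ = min δ₀ 1`, quarter step `s`
  set δ₁ : ℝ := min δ₀ 1 with hδ₁_def
  have hδ₁ : 0 < δ₁ := lt_min hδ₀ one_pos
  have hδ₁0 : δ₁ ≤ δ₀ := min_le_left _ _
  have hδ₁1 : δ₁ ≤ 1 := min_le_right _ _
  set s : ℝ := δ₁ / 4 with hs_def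
  have hs : 0 < s := by positivity
  obtain ⟨B, hB, hG⟩ := exists_ssResidual_extension A δ₁ K₀ hA hδ₁ hK₀
  refine ⟨s, 4 * (B / s) + 1, hs, by positivity, ?_⟩
  intro U W hU hUb hW hUW
  obtain ⟨G, hGd, hGb, hGW⟩ := hG U W (hU.mono (localComplexTube_mono le_rfl hδ₁0))
    (fun z hz => hUb z (localComplexTube_mono le_rfl hδ₁0 hz)) hW hUW
  have h2s : A + 1 - δ₁ / 2 = A + 1 - 2 * s ∧ δ₁ / 2 = 2 * s := by rw [hs_def]; constructor <;> ring
  rw [h2s.1, h2s.2] at hGd hGb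
  rw [h2s.1] at hGW
  -- round 3: `∂ₖ` of the residual's extension
  set e : Fin 3 → EuclideanSpace ℝ (Fin 3) := fun j => EuclideanSpace.single j (1 : ℝ) with he_def
  have he : ∀ j, ‖e j‖ ≤ 1 := fun j => by simp [he_def]
  have hNd : DifferentiableOn ℝ (ssResidual 1 W) (ball (0 : EuclideanSpace ℝ (Fin 3)) (A + 1 - 2 * s)) :=
    (differentiableOn_ssResidual hW).mono (ball_subset_ball (by linarith))
  set G₁ : Fin 3 → EuclideanSpace ℂ (Fin 3) → EuclideanSpace ℂ (Fin 3) := fun k z => fderiv ℂ G z (complexify (e k))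
    with hG₁_def
  have R3 : ∀ k, DifferentiableOn ℂ (G₁ k) (localComplexTube 0 (A + 1 - 2 * s) (2 * s)) ∧
      (∀ z ∈ localComplexTube (0 : EuclideanSpace ℝ (Fin 3)) (A + 1 - 2 * s - s) (2 * s - s), ‖G₁ k z‖ ≤ B / s) ∧
      ∀ y ∈ ball (0 : EuclideanSpace ℝ (Fin 3)) (A + 1 - 2 * s),
        G₁ k (complexify y) = complexify (fderiv ℝ (ssResidual 1 W) y (e k)) := fun k =>
    dirDeriv_extension (by positivity) hGd hGb hGW hNd hs (he k)
  -- the target tube sits inside the thrice-shrunken tube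
  have hsub : localComplexTube (0 : EuclideanSpace ℝ (Fin 3)) A s ⊆ localComplexTube 0 (A + 1 - 2 * s - s) (2 * s - s) :=
    localComplexTube_mono (by rw [hs_def]; linarith) (by linarith)
  have hsub' : localComplexTube (0 : EuclideanSpace ℝ (Fin 3)) A s ⊆ localComplexTube 0 (A + 1 - 2 * s) (2 * s) :=
    hsub.trans (localComplexTube_mono (by linarith) (by linarith))
  -- the curl, assembled from the components of `∂ₖ`
  set F : EuclideanSpace ℂ (Fin 3) → EuclideanSpace ℂ (Fin 3) := fun z =>
    WithLp.toLp 2 ![G₁ 1 z 2 - G₁ 2 z 1, G₁ 2 z 0 - G₁ 0 z 2, G₁ 0 z 1 - G₁ 1 z 0] with hF_def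
  have hcomp : ∀ k i, DifferentiableOn ℂ (fun z => G₁ k z i) (localComplexTube (0 : EuclideanSpace ℝ (Fin 3)) A s) :=
    fun k i => (EuclideanSpace.proj i : EuclideanSpace ℂ (Fin 3) →L[ℂ] ℂ).differentiable.comp_differentiableOn
      ((R3 k).1.mono hsub')
  have hF0 : ∀ z, F z 0 = G₁ 1 z 2 - G₁ 2 z 1 := fun z => by simp [hF_def]
  have hF1 : ∀ z, F z 1 = G₁ 2 z 0 - G₁ 0 z 2 := fun z => by simp [hF_def]
  have hF2 : ∀ z, F z 2 = G₁ 0 z 1 - G₁ 1 z 0 := fun z => by simp [hF_def]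
  refine ⟨F, ?_, ?_, ?_⟩
  · refine differentiableOn_euclidean.2 fun i => ?_
    fin_cases i
    · show DifferentiableOn ℂ (fun x => F x 0) _
      rw [funext hF0]; exact (hcomp 1 2).sub (hcomp 2 1)
    · show DifferentiableOn ℂ (fun x => F x 1) _
      rw [funext hF1]; exact (hcomp 2 0).sub (hcomp 0 2)
    · show DifferentiableOn ℂ (fun x => F x 2) _
      rw [funext hF2]; exact (hcomp 0 1).sub (hcomp 1 0)
  · intro z hz
    have hb : ∀ k i, ‖G₁ k z i‖ ≤ B / s := fun k i =>
      le_trans (by simpa using PiLp.norm_apply_le (p := 2) (G₁ k z) i) ((R3 k).2.1 z (hsub hz))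
    have hc : ∀ i, ‖F z i‖ ≤ 2 * (B / s) := by
      intro i
      rw [two_mul]
      fin_cases i
      · show ‖F z 0‖ ≤ _
        rw [hF0]; exact (norm_sub_le _ _).trans (add_le_add (hb 1 2) (hb 2 1))
      · show ‖F z 1‖ ≤ _
        rw [hF1]; exact (norm_sub_le _ _).trans (add_le_add (hb 2 0) (hb 0 2))
      · show ‖F z 2‖ ≤ _
        rw [hF2]; exact (norm_sub_le _ _).trans (add_le_add (hb 0 1) (hb 1 0))
    calc ‖F z‖ ≤ 2 * (2 * (B / s)) := norm_le_two_mul_of_forall_apply_le (by positivity) hc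
      _ ≤ 4 * (B / s) + 1 := by linarith
  · intro y hy
    have hyb : y ∈ ball (0 : EuclideanSpace ℝ (Fin 3)) (A + 1 - 2 * s) := by
      rw [mem_ball_zero_iff]; rw [hs_def]; linarith
    have a : ∀ k i, G₁ k (complexify y) i = ((fderiv ℝ (ssResidual 1 W) y (e k) i : ℝ) : ℂ) := fun k i => by
      rw [(R3 k).2.2 y hyb, complexify_apply]
    ext i
    fin_cases i <;>
      simp [hF_def, a, he_def, vortexDefect, curl, complexify_apply, Complex.ofReal_sub]

end Summit.NavierStokesRegularity.NavierStokesRegularity.Theorems.ScalingDefectPeepholeDoor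

end
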